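import Literature.Probability.RandomPlanarGeometry.ChordalCurveFamilyProofs
import Literature.Probability.RandomPlanarGeometry.SLEProofs
import HarnessLib

/-!
# Curve surgery of a time-compactified image at the first hitting of a closed set

Deterministic curve-space lemmas used to read the domain Markov property of chordal SLE
(Werner 2007, §3.2 condition (2): conditioning on the initial piece `γ[0, σ_F]` of the curve
stopped at its first hitting time `σ_F` of a closed set `F`) on the half-plane trace.

Let `c : [0, 1] → ℂ` be the time-compactified image of a half-infinite path `γ : ℝ≥0 → ℂ` under
`Φ : ℂ → ℂ` with end point `b` (`IsCompactifiedImage Φ γ b c`: `c u = Φ (γ (u / (1 - u)))` for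
`u < 1`, `c 1 = b`), and let `F ⊆ ℂ` be closed.

* `IsCompactifiedImage.hitParam_eq`: if `τ` is the first time with `Φ (γ τ) ∈ F`, the first
  hitting parameter of `F` by `c` is `τ / (1 + τ)` (the preimage of `τ` under `u ↦ u / (1 - u)`).
* `IsCompactifiedImage.eq_stopAt_reparam`, `CurveClass.stopAt_mk_eq_of_isCompactifiedImage` (A):
  any curve `cτ` parametrising `Φ ∘ γ` linearly on `[0, τ]` is the reparametrisation of the
  initial segment `c.stopAt F` by the Möbius time change `rayScale (1 + τ)`, hence
  `CurveClass.stopAt F (mk c) = mk cτ`.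
* `IsCompactifiedImage.startFrom`, `CurveClass.startFrom_mk_eq_of_isCompactifiedImage` (B): the
  final segment `c.startFrom F` is the compactified image of `t ↦ γ (τ + (1 + τ) t)`, hence its
  class is the class of the compactified image of `s ↦ γ (τ + s)` (time scaling does not change
  the class, `IsCompactifiedImage.mk_eq_of_comp_mul`).
* `IsCompactifiedImage.hitParam_eq_one`, `CurveClass.stopAt_startFrom_mk_eq_of_forall_notMem`
  (C): if `Φ ∘ γ` never visits `F`, the hitting parameter is `1` (whether or not `b ∈ F`), the
  stopped class is `mk c` and the restarted class is the constant class at `b`.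

All proofs are elementary algebra of the compactification `u ↦ u / (1 - u)` combined with the
representative independence `CurveClass.stopAt_mk_holds` / `startFrom_mk_holds`
(`ChordalCurveFamilyProofs`) and reparametrisation invariance of classes (`CurveClass.mk_reparam`).

Sources: W. Werner, *Lectures on two-dimensional critical percolation*, IAS/Park City (2007),
arXiv:0710.0856, §3.2 (2); G. Lawler, *Conformally Invariant Processes in the Plane* (2005), §6.3
(chordal SLE in a domain as a curve modulo time change). The statements themselves are folklore.
-/

noncomputable section

open Set Filter Topology
open scoped NNReal unitInterval

namespace Literature.Probability.RandomPlanarGeometry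

variable {Φ : ℂ → ℂ} {γ : ℝ≥0 → ℂ} {b : ℂ} {c : Curve ℂ} {F : Set ℂ}

/-! ### The hitting parameter of a compactified image -/

/-- The point `τ / (1 + τ)` of `[0, 1]`, preimage of `τ` under the compactification
`rayParam : u ↦ u / (1 - u)` (the inverse compactification `τ ↦ τ / (1 + τ)` is written out, not
introduced as a definition). [folklore] -/
theorem rayParamInv_mem_Icc (τ : ℝ≥0) : (τ : ℝ) / (1 + τ) ∈ Icc (0 : ℝ) 1 := by
  have hτ0 : (0 : ℝ) ≤ τ := τ.2
  have hpos : (0 : ℝ) < 1 + τ := by positivity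
  exact ⟨div_nonneg hτ0 hpos.le, (div_le_one hpos).2 (by linarith)⟩

/-- `τ / (1 + τ) < 1`: finite times correspond to parameters `< 1`. [folklore] -/
theorem rayParamInv_lt_one (τ : ℝ≥0) : (τ : ℝ) / (1 + τ) < 1 := by
  have hτ0 : (0 : ℝ) ≤ τ := τ.2
  have hpos : (0 : ℝ) < 1 + τ := by positivity
  rw [div_lt_one hpos]
  linarith

/-- `rayParam (τ / (1 + τ)) = τ`: the compactification inverts `τ ↦ τ / (1 + τ)`. [folklore] -/
theorem rayParam_rayParamInv (τ : ℝ≥0) : rayParam ⟨(τ : ℝ) / (1 + τ), rayParamInv_mem_Icc τ⟩ = τ := by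
  have hτ0 : (0 : ℝ) ≤ τ := τ.2
  have hpos : (0 : ℝ) < 1 + τ := by positivity
  ext
  simp only [coe_rayParam]
  field_simp
  ring

namespace IsCompactifiedImage

/-- **Hitting parameter of a compactified image.** If `τ` is the first time at which `Φ (γ τ) ∈ F`
then the first hitting parameter of `F` by the compactified image `c` is `τ / (1 + τ)`: indeed
`c (τ / (1 + τ)) = Φ (γ τ) ∈ F`, and a parameter `u < τ / (1 + τ)` has `u / (1 - u) < τ`, so
`c u = Φ (γ (u / (1 - u))) ∉ F`. [folklore] -/
theorem hitParam_eq (h : IsCompactifiedImage Φ γ b c) {τ : ℝ≥0} (hτ : Φ (γ τ) ∈ F)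
    (hbefore : ∀ s < τ, Φ (γ s) ∉ F) : c.hitParam F = τ / (1 + τ) := by
  have hτ0 : (0 : ℝ) ≤ τ := τ.2
  have hpos : (0 : ℝ) < 1 + τ := by positivity
  have hu1 := rayParamInv_lt_one τ
  refine le_antisymm (Curve.hitParam_le (t := ⟨_, rayParamInv_mem_Icc τ⟩) ?_)
    (le_csInf ⟨1, c.one_mem_hitSet F⟩ ?_)
  · rw [h.1 _ hu1, rayParam_rayParamInv]
    exact hτ
  · rintro x (⟨hxI, hxF⟩ | hx1)
    · by_contra hx
      rw [not_le] at hx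
      have hx1 : x < 1 := hx.trans hu1
      rw [h.1 ⟨x, hxI⟩ hx1] at hxF
      refine hbefore _ ?_ hxF
      -- `x / (1 - x) < τ` because `x < τ / (1 + τ)`
      rw [← NNReal.coe_lt_coe, coe_rayParam]
      change x / (1 - x) < τ
      rw [lt_div_iff₀ hpos] at hx
      rw [div_lt_iff₀ (sub_pos.2 hx1)]
      linarith
    · rw [mem_singleton_iff.1 hx1]
      exact hu1.le

/-- If `Φ ∘ γ` never visits `F`, the hitting parameter of `F` by the compactified image is `1`
(whether or not the end point `b = c 1` lies in `F`: if it does, `1` is the first hit; if not,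
by the convention `hitParam = 1` for a set that is never visited). [folklore] -/
theorem hitParam_eq_one (h : IsCompactifiedImage Φ γ b c) (hnever : ∀ s, Φ (γ s) ∉ F) :
    c.hitParam F = 1 := by
  refine le_antisymm (c.hitParam_mem_Icc F).2 (le_csInf ⟨1, c.one_mem_hitSet F⟩ ?_)
  rintro x (⟨hxI, hxF⟩ | hx1)
  · by_contra hx
    rw [h.1 ⟨x, hxI⟩ (lt_of_not_ge hx)] at hxF
    exact hnever _ hxF
  · rw [mem_singleton_iff.1 hx1]

/-! ### (A) The initial segment -/

/-- **The stopped compactified image is a Möbius reparametrisation of the linearly parametrised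
initial piece.** With `τ` the first time at which `Φ (γ τ) ∈ F` and `cτ u = Φ (γ (τ u))`, one has
`cτ = (c.stopAt F) ∘ rayScale (1 + τ)`: indeed `c.stopAt F v = c (τ v / (1 + τ))`, and for
`v = (1 + τ) u / (1 + τ u)` the parameter `τ v / (1 + τ) = τ u / (1 + τ u)` is sent to `τ u` by
the compactification `w ↦ w / (1 - w)`. [folklore] -/
theorem eq_stopAt_reparam (h : IsCompactifiedImage Φ γ b c) {τ : ℝ≥0} (hτ : Φ (γ τ) ∈ F)
    (hbefore : ∀ s < τ, Φ (γ s) ∉ F) (cτ : Curve ℂ)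
    (hcτ : ∀ u : I, cτ u = Φ (γ (τ * ⟨(u : ℝ), u.2.1⟩))) :
    cτ = (c.stopAt F).reparam
      (rayScale (1 + (τ : ℝ)) (add_pos_of_pos_of_nonneg one_pos τ.2)) := by
  have hτ0 : (0 : ℝ) ≤ τ := τ.2
  have hpos : (0 : ℝ) < 1 + τ := by positivity
  have hhit := h.hitParam_eq hτ hbefore
  refine DFunLike.ext cτ _ fun s ↦ ?_
  have hs0 : (0 : ℝ) ≤ s := s.2.1
  have hden : (0 : ℝ) < 1 + τ * s := by positivity
  -- the parameter of `c` at which the stopped, reparametrised curve is evaluated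
  have hyI : (τ : ℝ) * s / (1 + τ * s) ∈ Icc (0 : ℝ) 1 :=
    ⟨div_nonneg (by positivity) hden.le, (div_le_one hden).2 (by linarith)⟩
  have hy1 : (τ : ℝ) * s / (1 + τ * s) < 1 := (div_lt_one hden).2 (by linarith)
  have hprod : c.hitParam F * (rayScale (1 + (τ : ℝ)) hpos s : I) = τ * s / (1 + τ * s) := by
    rw [hhit, coe_rayScale, add_sub_cancel_left]
    field_simp
  have hray : rayParam ⟨(τ : ℝ) * s / (1 + τ * s), hyI⟩ = τ * ⟨(s : ℝ), s.2.1⟩ := by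
    ext
    rw [coe_rayParam, NNReal.coe_mul]
    change (τ : ℝ) * s / (1 + τ * s) / (1 - τ * s / (1 + τ * s)) = τ * s
    have h1 : (1 : ℝ) - τ * s / (1 + τ * s) = 1 / (1 + τ * s) := by
      field_simp
      ring
    rw [h1, div_div_div_cancel_right₀ hden.ne', div_one]
  calc cτ s = Φ (γ (τ * ⟨(s : ℝ), s.2.1⟩)) := hcτ s
    _ = c ⟨(τ : ℝ) * s / (1 + τ * s), hyI⟩ := by rw [h.1 _ hy1, hray]
    _ = (c.stopAt F).reparam (rayScale (1 + (τ : ℝ)) hpos) s := by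
        rw [Curve.reparam_apply, Curve.stopAt_apply, hprod, projIcc_of_mem zero_le_one hyI]

end IsCompactifiedImage

/-- **(A) The stopped class of a compactified image.** Let `c` be the compactified image of `γ`
under `Φ` and `F` closed, and let `τ` be the first time with `Φ (γ τ) ∈ F`. Then the class of `c`
stopped at its first hitting of `F` is the class of ANY curve `cτ` parametrising `Φ ∘ γ` linearly
on `[0, τ]`, `cτ u = Φ (γ (τ u))` (the product `τ u` taken in `ℝ≥0`, `u ∈ [0, 1]` coerced through
`⟨u, _⟩ : ℝ≥0`). This is the deterministic half of reading Werner's conditioning on `γ[0, σ_F]`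
on the half-plane trace. [cite: Werner2007, §3.2 (2)] -/
theorem CurveClass.stopAt_mk_eq_of_isCompactifiedImage (h : IsCompactifiedImage Φ γ b c)
    (hF : IsClosed F) {τ : ℝ≥0} (hτ : Φ (γ τ) ∈ F) (hbefore : ∀ s < τ, Φ (γ s) ∉ F)
    (cτ : Curve ℂ) (hcτ : ∀ u : I, cτ u = Φ (γ (τ * ⟨(u : ℝ), u.2.1⟩))) :
    CurveClass.stopAt F (CurveClass.mk c) = CurveClass.mk cτ := by
  rw [CurveClass.stopAt_mk_holds F hF c, h.eq_stopAt_reparam hτ hbefore cτ hcτ,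
    CurveClass.mk_reparam]

/-! ### (B) The final segment -/

namespace IsCompactifiedImage

/-- **The final segment of a compactified image is a compactified image.** With `τ` the first time
at which `Φ (γ τ) ∈ F`, the final segment `c.startFrom F` (`s ↦ c (u⋆ + (1 - u⋆) s)`,
`u⋆ = τ / (1 + τ)`) is the compactified image of the time-changed tail `t ↦ γ (τ + (1 + τ) t)`:
`(u⋆ + (1 - u⋆) s) / (1 - u⋆ - (1 - u⋆) s) = τ + (1 + τ) s / (1 - s)`. [folklore] -/
theorem startFrom (h : IsCompactifiedImage Φ γ b c) {τ : ℝ≥0} (hτ : Φ (γ τ) ∈ F)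
    (hbefore : ∀ s < τ, Φ (γ s) ∉ F) :
    IsCompactifiedImage Φ (fun t ↦ γ (τ + (1 + τ) * t)) b (c.startFrom F) := by
  have hτ0 : (0 : ℝ) ≤ τ := τ.2
  have hpos : (0 : ℝ) < 1 + τ := by positivity
  have hhit := h.hitParam_eq hτ hbefore
  refine ⟨fun s hs ↦ ?_, ?_⟩
  · have hs0 : (0 : ℝ) ≤ s := s.2.1
    have hyI : ((τ : ℝ) + s) / (1 + τ) ∈ Icc (0 : ℝ) 1 :=
      ⟨div_nonneg (by positivity) hpos.le, (div_le_one hpos).2 (by linarith [s.2.2])⟩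
    have hy1 : ((τ : ℝ) + s) / (1 + τ) < 1 := (div_lt_one hpos).2 (by linarith)
    have hsum : c.hitParam F + (1 - c.hitParam F) * s = ((τ : ℝ) + s) / (1 + τ) := by
      rw [hhit]
      field_simp
      ring
    rw [Curve.startFrom_apply, hsum, projIcc_of_mem zero_le_one hyI, h.1 _ hy1]
    congr 2
    ext
    push_cast
    rw [coe_rayParam, coe_rayParam]
    change ((τ : ℝ) + s) / (1 + τ) / (1 - (τ + s) / (1 + τ)) = τ + (1 + τ) * (s / (1 - s))
    have h1s : (1 : ℝ) - s ≠ 0 := (sub_pos.2 hs).ne'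
    have h1 : (1 : ℝ) - (τ + s) / (1 + τ) = (1 - s) / (1 + τ) := by
      field_simp
      ring
    rw [h1, div_div_div_cancel_right₀ hpos.ne']
    field_simp
    ring
  · rw [← Curve.target_def, Curve.target_startFrom, Curve.target_def]
    exact h.2

end IsCompactifiedImage

/-- **(B) The restarted class of a compactified image.** Let `c` be the compactified image of `γ`
under `Φ`, `F` closed, `τ` the first time with `Φ (γ τ) ∈ F`, and `c'` the compactified image of
the tail `s ↦ γ (τ + s)` (same `Φ`, same end point `b`). Then the class of the final segment of
`c` from its first hitting of `F` is the class of `c'` (the two differ by the time scaling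
`s = (1 + τ) t`, invisible modulo reparametrisation). Werner's "conditional law of `γ[t, ∞)`"
read on the trace. [cite: Werner2007, §3.2 (2)] -/
theorem CurveClass.startFrom_mk_eq_of_isCompactifiedImage (h : IsCompactifiedImage Φ γ b c)
    (hF : IsClosed F) {τ : ℝ≥0} (hτ : Φ (γ τ) ∈ F) (hbefore : ∀ s < τ, Φ (γ s) ∉ F)
    {c' : Curve ℂ} (hc' : IsCompactifiedImage Φ (fun s ↦ γ (τ + s)) b c') :
    CurveClass.startFrom F (CurveClass.mk c) = CurveClass.mk c' := by
  rw [CurveClass.startFrom_mk_holds F hF c]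
  have hne : (1 + τ : ℝ≥0) ≠ 0 := by positivity
  exact IsCompactifiedImage.mk_eq_of_comp_mul hne hc' (h.startFrom hτ hbefore)

/-! ### (C) No hitting -/

/-- **(C) Surgery of a compactified image that never meets `F`.** If `Φ (γ s) ∉ F` for all `s`
then (for closed `F`) the class of `c` stopped on `F` is the class of `c` itself and the restarted
class is the class of the constant curve at the end point `b` — whether or not `b ∈ F`: the hitting
parameter is `1` in both cases. [folklore] -/
theorem CurveClass.stopAt_startFrom_mk_eq_of_forall_notMem (h : IsCompactifiedImage Φ γ b c)
    (hF : IsClosed F) (hnever : ∀ s, Φ (γ s) ∉ F) :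
    CurveClass.stopAt F (CurveClass.mk c) = CurveClass.mk c ∧
      CurveClass.startFrom F (CurveClass.mk c) = CurveClass.mk (Curve.const b) := by
  have h1 := h.hitParam_eq_one hnever
  rw [CurveClass.stopAt_mk_holds F hF c, CurveClass.startFrom_mk_holds F hF c,
    Curve.stopAt_eq_self_of_hitParam_eq_one h1, Curve.startFrom_eq_const_of_hitParam_eq_one h1,
    Curve.target_def, h.2]
  exact ⟨rfl, rfl⟩

end Literature.Probability.RandomPlanarGeometry

end
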